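import Literature.Probability.RandomPlanarGeometry.LoopErasure
import Literature.Probability.LatticeModels.LatticeGraph
import HarnessLib

/-!
# Fomin's tail swap for two paths (line `symplectic-fermion-anchor`, crux
`SAWLoopFugacityFlow.AvoidanceLimit`, stmt-CriticalPhenomena-10649; brick F1 of the (CR) toolbox)

The combinatorial core of Fomin's identity for two paths (Fomin 2001; Lawler–Limic, *Random walk:
a modern introduction*, §9.5; Kozdron, arXiv:math/0703615, proof of Thm. 3.2): on pairs of finite
paths `(ω¹, ω²)` such that `ω²` meets the chronological loop erasure `LE(ω¹)`, let the **pivot** `v`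
be the first vertex of `LE(ω¹)` (in the order of that self-avoiding path) visited by `ω²`, cut BOTH
paths at their LAST visit of `v` and exchange the tails:

`Φ(ω¹, ω²) = (ω¹[0, σ¹] ⊕ ω²(σ², end], ω²[0, σ²] ⊕ ω¹(σ¹, end])`, `σⁱ = max{j : ωⁱⱼ = v}`.

We prove (`exists_fominSwap`) that `Φ` maps the domain to itself and is an involution there, keeps
the initial vertices, exchanges the final vertices, preserves the total number of vertices and the
set of visited vertices (hence path weights), and maps pairs of nearest-neighbour paths to pairs of
nearest-neighbour paths. The heart of the matter is the chronological structure of loop erasure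
(`loopErase_throughLast_append`): if `LE(ω) = P ⊕ v ⊕ Q`, then for every continuation `r`
avoiding `v` and `P`, `LE(ω[0, σ] ⊕ r) = P ⊕ v ⊕ LE(r)` — the vertices of `LE(ω)` before `v` are
determined by `ω` up to the last visit of `v`, so the pivot of `Φ(ω¹, ω²)` is again `v`.

Pure list combinatorics over the tree file `Literature/Probability/RandomPlanarGeometry/LoopErasure`
(`throughLast`, `afterLast`, `loopErase`); stated for a general vertex type with decidable equality
and specialised to `Site 2`.
-/

noncomputable section

open Literature.Probability.RandomPlanarGeometry Literature.Probability.LatticeModels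

namespace Summit.CriticalPhenomena.SAWScalingLimit.Theorems.AvoidanceLimit.Anchor

section General

variable {V : Type*} [DecidableEq V]

/-! ### Complements on the last-occurrence splitting -/

/-- If `v ∈ l` then `throughLast v l` is nonempty. [folklore] -/
theorem throughLast_ne_nil_of_mem {v : V} {l : List V} (h : v ∈ l) : throughLast v l ≠ [] :=
  fun h0 => throughLast_eq_nil_iff.1 h0 h

/-- If `v ∈ l` then `throughLast v l` ends in `v`. [folklore] -/
theorem getLast?_throughLast_of_mem {v : V} {l : List V} (h : v ∈ l) :
    (throughLast v l).getLast? = some v :=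
  (throughLast_eq_nil_or_getLast? v l).resolve_left (throughLast_ne_nil_of_mem h)

/-- If `v ∈ a :: t` then `a :: throughLast v t` ends in `v`. [folklore] -/
theorem getLast?_cons_throughLast_of_mem {v a : V} {t : List V} (h : v ∈ a :: t) :
    (a :: throughLast v t).getLast? = some v := by
  by_cases ht : v ∈ t
  · rw [getLast?_cons_of_ne_nil a (throughLast_ne_nil_of_mem ht)]
    exact getLast?_throughLast_of_mem ht
  · have hva : v = a := (List.mem_cons.1 h).resolve_right ht
    rw [throughLast_eq_nil_iff.2 ht, hva]
    rfl

/-- Splitting a cons at a vertex it contains: prefix part. [folklore] -/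
theorem throughLast_cons_of_mem {v a : V} {t : List V} (h : v ∈ a :: t) :
    throughLast v (a :: t) = a :: throughLast v t :=
  calc throughLast v (a :: t) = throughLast v ((a :: throughLast v t) ++ afterLast v t) := by
        rw [List.cons_append, throughLast_append_afterLast]
    _ = a :: throughLast v t :=
        throughLast_append_of (Or.inr (getLast?_cons_throughLast_of_mem h)) (not_mem_afterLast v t)

/-- Splitting a cons at a vertex it contains: suffix part. [folklore] -/
theorem afterLast_cons_of_mem {v a : V} {t : List V} (h : v ∈ a :: t) :
    afterLast v (a :: t) = afterLast v t :=
  calc afterLast v (a :: t) = afterLast v ((a :: throughLast v t) ++ afterLast v t) := by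
        rw [List.cons_append, throughLast_append_afterLast]
    _ = afterLast v t :=
        afterLast_append_of (Or.inr (getLast?_cons_throughLast_of_mem h)) (not_mem_afterLast v t)

/-- Appending a list avoiding `a` does not move the last occurrence of `a`: suffix part.
[folklore] -/
theorem afterLast_append_of_not_mem_right {a : V} (c : List V) {r : List V} (hr : a ∉ r) :
    afterLast a (c ++ r) = afterLast a c ++ r :=
  calc afterLast a (c ++ r) = afterLast a (throughLast a c ++ (afterLast a c ++ r)) := by
        rw [← List.append_assoc, throughLast_append_afterLast]
    _ = afterLast a c ++ r :=
        afterLast_append_of (throughLast_eq_nil_or_getLast? a c)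
          (fun h => (List.mem_append.1 h).elim (not_mem_afterLast a c) hr)

/-- If the last `v` of `t` comes after the last `a` (i.e. `v ∈ afterLast a t`), the prefix of `t`
through its last `v` is the prefix through its last `a` followed by the prefix of the remainder
through its last `v`. [folklore] -/
theorem throughLast_of_mem_afterLast {a v : V} {t : List V} (hv : v ∈ afterLast a t) :
    throughLast v t = throughLast a t ++ throughLast v (afterLast a t) := by
  have hc : (throughLast a t ++ throughLast v (afterLast a t)).getLast? = some v := by
    rw [getLast?_append_of_ne_nil' _ (throughLast_ne_nil_of_mem hv)]
    exact getLast?_throughLast_of_mem hv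
  calc throughLast v t = throughLast v
        ((throughLast a t ++ throughLast v (afterLast a t)) ++ afterLast v (afterLast a t)) := by
          rw [List.append_assoc, throughLast_append_afterLast, throughLast_append_afterLast]
    _ = throughLast a t ++ throughLast v (afterLast a t) :=
        throughLast_append_of (Or.inr hc) (not_mem_afterLast v _)

/-- If `v ∈ afterLast a t`, the part of `t` after its last `v` is the part of `afterLast a t`
after its last `v`. [folklore] -/
theorem afterLast_of_mem_afterLast {a v : V} {t : List V} (hv : v ∈ afterLast a t) :
    afterLast v t = afterLast v (afterLast a t) := by
  have hc : (throughLast a t ++ throughLast v (afterLast a t)).getLast? = some v := by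
    rw [getLast?_append_of_ne_nil' _ (throughLast_ne_nil_of_mem hv)]
    exact getLast?_throughLast_of_mem hv
  calc afterLast v t = afterLast v
        ((throughLast a t ++ throughLast v (afterLast a t)) ++ afterLast v (afterLast a t)) := by
          rw [List.append_assoc, throughLast_append_afterLast, throughLast_append_afterLast]
    _ = afterLast v (afterLast a t) := afterLast_append_of (Or.inr hc) (not_mem_afterLast v _)

/-- If `v ∈ afterLast a t`, cutting after the last `a` and cutting through the last `v` commute.
[folklore] -/
theorem afterLast_throughLast_of_mem_afterLast {a v : V} {t : List V} (hv : v ∈ afterLast a t) :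
    afterLast a (throughLast v t) = throughLast v (afterLast a t) := by
  rw [throughLast_of_mem_afterLast hv]
  exact afterLast_append_of (throughLast_eq_nil_or_getLast? a t)
    (fun h => not_mem_afterLast a t ((throughLast_prefix v _).subset h))

/-- Cutting `l` through its last `v ∈ l` keeps the initial vertex, whatever is appended.
[folklore] -/
theorem head?_throughLast_append {v : V} {l : List V} (h : v ∈ l) (r : List V) :
    (throughLast v l ++ r).head? = l.head? :=
  have hne := throughLast_ne_nil_of_mem h
  calc (throughLast v l ++ r).head? = (throughLast v l).head? := List.head?_append_of_ne_nil _ hne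
    _ = (throughLast v l ++ afterLast v l).head? := (List.head?_append_of_ne_nil _ hne).symm
    _ = l.head? := by rw [throughLast_append_afterLast]

/-- The swapped path `l[0, σ_l] ⊕ m(σ_m, end]` ends where `m` ends (`v ∈ l`, `v ∈ m`). [folklore] -/
theorem getLast?_throughLast_append_afterLast {v : V} {l m : List V} (hl : v ∈ l) (hm : v ∈ m) :
    (throughLast v l ++ afterLast v m).getLast? = m.getLast? := by
  by_cases h : afterLast v m = []
  · rw [h, List.append_nil, getLast?_throughLast_of_mem hl]
    rcases eq_nil_or_getLast?_of_afterLast_eq_nil h with rfl | h'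
    · simp at hm
    · exact h'.symm
  · calc (throughLast v l ++ afterLast v m).getLast? = (afterLast v m).getLast? :=
          getLast?_append_of_ne_nil' _ h
      _ = (throughLast v m ++ afterLast v m).getLast? := (getLast?_append_of_ne_nil' _ h).symm
      _ = m.getLast? := by rw [throughLast_append_afterLast]

/-- The swapped path `l[0, σ_l] ⊕ m(σ_m, end]` of two `R`-chains through `v` is an `R`-chain (the
junction is the step of `m` out of its last visit of `v`). [folklore] -/
theorem isChain_throughLast_append_afterLast {R : V → V → Prop} {v : V} {l m : List V}
    (hl : List.IsChain R l) (hm : List.IsChain R m) (hvl : v ∈ l) (hvm : v ∈ m) :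
    List.IsChain R (throughLast v l ++ afterLast v m) := by
  rw [← throughLast_append_afterLast v l, List.isChain_append] at hl
  rw [← throughLast_append_afterLast v m, List.isChain_append] at hm
  rw [List.isChain_append]
  refine ⟨hl.1, hm.2.1, fun x hx y hy => hm.2.2 x ?_ y hy⟩
  rw [getLast?_throughLast_of_mem hvm]
  rwa [getLast?_throughLast_of_mem hvl] at hx

/-! ### The chronological structure of loop erasure -/

/-- **Chronological structure of `LE`, I.** If `LE(l) = P ⊕ v ⊕ Q`, the vertices of `P` are not
visited by `l` after its last visit of `v` (their last visits precede that of `v`). [folklore] -/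
theorem not_mem_afterLast_of_loopErase_eq : ∀ (l : List V) {v : V} {P Q : List V},
    loopErase l = P ++ v :: Q → ∀ x ∈ P, x ∉ afterLast v l
  | [], _, _, _, h => absurd h (by simp)
  | a :: t, v, P, Q, h => by
    rw [loopErase_cons] at h
    cases P with
    | nil => simp
    | cons p P =>
      rw [List.cons_append, List.cons.injEq] at h
      obtain ⟨hap, h⟩ := h
      rw [← hap]
      have hv : v ∈ afterLast a t := loopErase_subset _ (by rw [h]; simp)
      have hvt : v ∈ a :: t := List.mem_cons_of_mem a ((afterLast_suffix a t).subset hv)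
      rw [afterLast_cons_of_mem hvt, afterLast_of_mem_afterLast hv]
      intro x hx
      rcases List.mem_cons.1 hx with rfl | hx
      · exact fun h' => not_mem_afterLast _ t ((afterLast_suffix v _).subset h')
      · exact not_mem_afterLast_of_loopErase_eq (afterLast a t) h x hx
termination_by l => l.length
decreasing_by exact Nat.lt_succ_of_le (length_afterLast_le _ _)

/-- **Chronological structure of `LE`, II (the key lemma of Fomin's involution).** If
`LE(l) = P ⊕ v ⊕ Q`, then for every continuation `r` avoiding `v` and the vertices of `P`,
`LE(l[0, σ] ⊕ r) = P ⊕ v ⊕ LE(r)`, `σ` the last visit of `v`: the erasure up to `v` only depends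
on the path up to its last visit of `v`. [cite: LawlerLimic2010, §9.5] -/
theorem loopErase_throughLast_append : ∀ (l : List V) {v : V} {P Q : List V},
    loopErase l = P ++ v :: Q → ∀ {r : List V}, v ∉ r → (∀ x ∈ P, x ∉ r) →
      loopErase (throughLast v l ++ r) = P ++ v :: loopErase r
  | [], _, _, _, h, _, _, _ => absurd h (by simp)
  | a :: t, v, P, Q, h, r, hvr, hPr => by
    rw [loopErase_cons] at h
    cases P with
    | nil =>
      rw [List.nil_append, List.cons.injEq] at h
      obtain ⟨hav, -⟩ := h
      rw [← hav] at hvr ⊢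
      rw [throughLast_cons_of_mem List.mem_cons_self, List.cons_append, loopErase_cons,
        afterLast_append_of (throughLast_eq_nil_or_getLast? a t) hvr, List.nil_append]
    | cons p P =>
      rw [List.cons_append, List.cons.injEq] at h
      obtain ⟨hap, h⟩ := h
      rw [← hap] at hPr ⊢
      have hv : v ∈ afterLast a t := loopErase_subset _ (by rw [h]; simp)
      have hvt : v ∈ a :: t := List.mem_cons_of_mem a ((afterLast_suffix a t).subset hv)
      have har : a ∉ r := hPr a List.mem_cons_self
      rw [throughLast_cons_of_mem hvt, List.cons_append, loopErase_cons,
        afterLast_append_of_not_mem_right _ har, afterLast_throughLast_of_mem_afterLast hv,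
        loopErase_throughLast_append (afterLast a t) h hvr
          (fun x hx => hPr x (List.mem_cons_of_mem _ hx)),
        List.cons_append]
termination_by l => l.length
decreasing_by exact Nat.lt_succ_of_le (length_afterLast_le _ _)

/-! ### The involution -/

/-- **Fomin's tail swap (general vertex type).** There is a map `Φ` on pairs of paths which, on
the pairs `(l₁, l₂)` with `l₂ ∩ LE(l₁) ≠ ∅`, stays in that set, is an involution, preserves the
total length, the initial vertices and the set of visited vertices, exchanges the final vertices,
and preserves the nearest-neighbour property for any adjacency relation `R`. The map cuts both
paths at their last visit of the pivot (the first vertex of `LE(l₁)` visited by `l₂`) and exchanges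
the tails. [cite: LawlerLimic2010, §9.5] -/
theorem exists_fominSwap_general :
    ∃ Φ : List V × List V → List V × List V,
      ∀ l₁ l₂ : List V, (∃ z ∈ l₂, z ∈ loopErase l₁) →
        (∃ z ∈ (Φ (l₁, l₂)).2, z ∈ loopErase (Φ (l₁, l₂)).1) ∧
        Φ (Φ (l₁, l₂)) = (l₁, l₂) ∧
        (Φ (l₁, l₂)).1.length + (Φ (l₁, l₂)).2.length = l₁.length + l₂.length ∧
        (Φ (l₁, l₂)).1.head? = l₁.head? ∧ (Φ (l₁, l₂)).2.head? = l₂.head? ∧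
        (Φ (l₁, l₂)).1.getLast? = l₂.getLast? ∧ (Φ (l₁, l₂)).2.getLast? = l₁.getLast? ∧
        (∀ z : V, (z ∈ (Φ (l₁, l₂)).1 ∨ z ∈ (Φ (l₁, l₂)).2) ↔ (z ∈ l₁ ∨ z ∈ l₂)) ∧
        (∀ R : V → V → Prop, List.IsChain R l₁ → List.IsChain R l₂ →
          List.IsChain R (Φ (l₁, l₂)).1 ∧ List.IsChain R (Φ (l₁, l₂)).2) := by
  -- the swap: pivot `v` = first vertex of `LE(l₁)` visited by `l₂`; identity off the domain
  let Φ : List V × List V → List V × List V := fun q =>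
    ((loopErase q.1).find? fun x => decide (x ∈ q.2)).elim q fun v =>
      (throughLast v q.1 ++ afterLast v q.2, throughLast v q.2 ++ afterLast v q.1)
  have hΦ : ∀ (l₁ l₂ : List V) (v : V), (loopErase l₁).find? (fun x => decide (x ∈ l₂)) = some v →
      Φ (l₁, l₂) = (throughLast v l₁ ++ afterLast v l₂, throughLast v l₂ ++ afterLast v l₁) := by
    intro l₁ l₂ v h
    dsimp only [Φ]
    rw [h]
    rfl
  refine ⟨Φ, fun l₁ l₂ hdom => ?_⟩
  -- the pivot and the decomposition `LE(l₁) = P ++ v :: Q`, no vertex of `P` visited by `l₂`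
  obtain ⟨v, hv⟩ : ∃ v, (loopErase l₁).find? (fun x => decide (x ∈ l₂)) = some v := by
    rw [← Option.isSome_iff_exists, List.find?_isSome]
    obtain ⟨z, hz₂, hz₁⟩ := hdom
    exact ⟨z, hz₁, decide_eq_true hz₂⟩
  obtain ⟨hv₂, P, Q, hPQ, hP⟩ := List.find?_eq_some_iff_append.1 hv
  replace hv₂ : v ∈ l₂ := of_decide_eq_true hv₂
  replace hP : ∀ x ∈ P, x ∉ l₂ := fun x hx => by simpa using hP x hx
  have hv₁ : v ∈ l₁ := loopErase_subset l₁ (by rw [hPQ]; simp)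
  -- the loop erasure of the swapped first path, and the pivot of the swapped pair
  have hLE : loopErase (throughLast v l₁ ++ afterLast v l₂) = P ++ v :: loopErase (afterLast v l₂) :=
    loopErase_throughLast_append l₁ hPQ (not_mem_afterLast v l₂)
      (fun x hx h => hP x hx ((afterLast_suffix v l₂).subset h))
  have hv₂' : v ∈ throughLast v l₂ ++ afterLast v l₁ :=
    List.mem_append_left _ (mem_throughLast_iff.2 hv₂)
  have hP' : ∀ x ∈ P, x ∉ throughLast v l₂ ++ afterLast v l₁ := fun x hx h =>
    (List.mem_append.1 h).elim (fun h' => hP x hx ((throughLast_prefix v l₂).subset h'))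
      (not_mem_afterLast_of_loopErase_eq l₁ hPQ x hx)
  have hv' : (loopErase (throughLast v l₁ ++ afterLast v l₂)).find?
      (fun x => decide (x ∈ throughLast v l₂ ++ afterLast v l₁)) = some v :=
    List.find?_eq_some_iff_append.2
      ⟨decide_eq_true hv₂', P, _, hLE, fun x hx => by simpa using hP' x hx⟩
  rw [hΦ l₁ l₂ v hv]
  dsimp only
  rw [hΦ _ _ v hv']
  refine ⟨⟨v, hv₂', by rw [hLE]; simp⟩, ?_, ?_, head?_throughLast_append hv₁ _,
    head?_throughLast_append hv₂ _, getLast?_throughLast_append_afterLast hv₁ hv₂,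
    getLast?_throughLast_append_afterLast hv₂ hv₁, fun z => ?_, fun R h₁ h₂ =>
    ⟨isChain_throughLast_append_afterLast h₁ h₂ hv₁ hv₂,
      isChain_throughLast_append_afterLast h₂ h₁ hv₂ hv₁⟩⟩
  · -- involution: the pivot of the swapped pair is again `v`
    rw [throughLast_append_of (throughLast_eq_nil_or_getLast? v l₁) (not_mem_afterLast v l₂),
      afterLast_append_of (throughLast_eq_nil_or_getLast? v l₂) (not_mem_afterLast v l₁),
      throughLast_append_of (throughLast_eq_nil_or_getLast? v l₂) (not_mem_afterLast v l₁),
      afterLast_append_of (throughLast_eq_nil_or_getLast? v l₁) (not_mem_afterLast v l₂),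
      throughLast_append_afterLast, throughLast_append_afterLast]
  · -- total length
    have e₁ := congrArg List.length (throughLast_append_afterLast v l₁)
    have e₂ := congrArg List.length (throughLast_append_afterLast v l₂)
    simp only [List.length_append] at e₁ e₂ ⊢
    omega
  · -- visited vertices
    have m₁ : z ∈ l₁ ↔ z ∈ throughLast v l₁ ∨ z ∈ afterLast v l₁ := by
      rw [← List.mem_append, throughLast_append_afterLast]
    have m₂ : z ∈ l₂ ↔ z ∈ throughLast v l₂ ∨ z ∈ afterLast v l₂ := by
      rw [← List.mem_append, throughLast_append_afterLast]
    rw [List.mem_append, List.mem_append, m₁, m₂]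
    tauto

end General

/-- **F1: Fomin's tail swap as an involution (two paths on `ℤ²`).** There is a map `Φ` on pairs
of lattice paths which, restricted to the pairs `(l₁, l₂)` such that `l₂` meets the chronological
loop erasure `LE(l₁)`, stays in that set and is an involution; it preserves the total number of
vertices, the initial vertices and the set of visited vertices, exchanges the final vertices, and
maps pairs of `R`-chains to pairs of `R`-chains for every relation `R` (nearest-neighbour paths of
any graph on `Site 2`). This is the sign-reversing involution behind Fomin's `2 × 2` determinant
identity (the free direction of the annular cross-ratio bound). [cite: LawlerLimic2010, §9.5] -/
theorem exists_fominSwap :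
    ∃ Φ : List (Site 2) × List (Site 2) → List (Site 2) × List (Site 2),
      ∀ l₁ l₂ : List (Site 2), (∃ z ∈ l₂, z ∈ loopErase l₁) →
        (∃ z ∈ (Φ (l₁, l₂)).2, z ∈ loopErase (Φ (l₁, l₂)).1) ∧
        Φ (Φ (l₁, l₂)) = (l₁, l₂) ∧
        (Φ (l₁, l₂)).1.length + (Φ (l₁, l₂)).2.length = l₁.length + l₂.length ∧
        (Φ (l₁, l₂)).1.head? = l₁.head? ∧ (Φ (l₁, l₂)).2.head? = l₂.head? ∧
        (Φ (l₁, l₂)).1.getLast? = l₂.getLast? ∧ (Φ (l₁, l₂)).2.getLast? = l₁.getLast? ∧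
        (∀ z : Site 2, (z ∈ (Φ (l₁, l₂)).1 ∨ z ∈ (Φ (l₁, l₂)).2) ↔ (z ∈ l₁ ∨ z ∈ l₂)) ∧
        (∀ R : Site 2 → Site 2 → Prop, List.IsChain R l₁ → List.IsChain R l₂ →
          List.IsChain R (Φ (l₁, l₂)).1 ∧ List.IsChain R (Φ (l₁, l₂)).2) :=
  exists_fominSwap_general

end Summit.CriticalPhenomena.SAWScalingLimit.Theorems.AvoidanceLimit.Anchor

end
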